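import Literature.IUT.HodgeTheaters.KitNFSideDatum
import Literature.IUT.HodgeTheaters.KitNFSideNonVacuityWitness
import Literature.IUT.HodgeTheaters.KitNFSideEval
import Literature.IUT.HodgeTheaters.KitCoreBridgeWitness

/-!
# NV-L5 witness: a CLOSED inhabitant of `BaseThetaDatum.KitCore.NFLink` over the datum built from the kits
# (`BaseThetaDatum.ofKitCore` / `KitCore.ofKit` / `NFLink.ofKit`, [IUTchI] Def 4.1, Ex 4.3–4.5, Def 6.1) —
# post-freeze additive D13, WITNESS class, not a cone member, not citable at 11:30Z

S. Mochizuki, *Inter-universal Teichmüller theory I*, kurims manuscript (May 2020), Definition 4.1 (i)–(vi) pp. 95–97,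
Example 4.3 (ii) p. 99, Example 4.4 (i)(ii) pp. 105–107, Example 4.5 (i)(ii) pp. 107–108, Definition 6.1 (v) p. 158
([IUTchI] Ex 4.3 (ii) p.99) [claim: Mochizuki2012, status: disputed] (D-0012 claim key, series status DISPUTED; this is a
CONSISTENCY / NON-VACUITY witness for hypothesis structures of the cell's typing — nothing of the series is asserted,
no side is taken on [IUTchIII] Cor. 3.12).

## What is witnessed (L5-lead RULINGS #42 (1); NV-L5 census v3 zero-producer row `BaseThetaDatum.KitCore.NFLink`)

abc-iut-L5-t3's parametric producer `BaseThetaDatum.NFLink.ofKit K hl5 hba hb N B E` (`KitNFSideDatum.lean`) inhabits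
`(KitCore.ofKit K hl5 hba hb N B E).NFLink` for ANY base kit `K` with `𝕍^bad ≠ ∅`, `𝕍^bad ∩ 𝕍^arc = ∅`, an NF kit
`N : K.NFKit`, a mono-analytic binder `B` and an evaluation-section binder `E`.  The only closed NF kit of the tree,
abc-iut-L5-t3's `NFKit.toy` (`KitNFSideNonVacuityWitness.lean`), lives over abc-iut-L5-t4's `toyKit`, which has
`𝕍^bad = ∅` — so it cannot be fed to `ofKitCore` (`hb : K.bad.Nonempty`), and over a kit WITH a bad place an
evaluation-section binder needs `≥ l^⋇ + 1 ≥ 3` label-rigid classes of endomorphisms of `𝒟_v`, which `toyKit`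
(`End(𝒟_v) = {±1}`) cannot host.  This file closes the gap with three small TRANSPORTS and one closed assembly:

* `PMBaseKit.NFKit.withPlaces` — an NF kit does not see `𝕍^bad`/`𝕍^arc`: transport of `N : K.NFKit` to the kit
  `{K with bad := b, arc := a}` (every field copied);
* `PMBaseKit.NFKit.thicken` — transport of an NF kit along abc-iut-L5-t3's thickening `K ↦ K.thicken`
  (`KitCoreBridgeWitness.lean`: ambient categories `K.Amb v × Thick`, `Thick` = one object with endomorphism monoid
  `(ℕ, +)`): global side unchanged, `†𝒟^⊚` seen at `v` = `(nfAtV, pt)`, local label torsors / `η_v` / label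
  pull-backs read through the first projection;
* `PMBaseKit.EvalBinder.thick` — over ANY thickened kit, the evaluation sections of label `j ∈ |𝔽_l|` are the
  morphisms whose `Thick`-component is `|j| + 1` (never an isomorphism; closed under composition with isomorphisms,
  whose `Thick`-component is `0`; labels well defined) — the same classes as abc-iut-L5-t3's `thickDatum`;
* `PMBaseKit.toyKitBad` — abc-iut-L5-t4's toy kit with its unique place declared BAD (as inlined in
  `exists_kitCore_thetaAgrees`), and the CLOSED inhabitant `BaseThetaDatum.KitCore.NFLink.toy l hl5` of
  `(KitCore.ofKit (toyKitBad l).thicken hl5 … ((NFKit.toy l).withPlaces …).thicken (MonoBinder.tautological _)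
  (EvalBinder.thick _)).NFLink` for every prime `l ≥ 5`, with `Nonempty`/`∃`-packagings
  (`KitCore.NFLink.nonempty_toy`, `exists_kitCore_nfLink`, `exists_kitCore_nfLink_five`).

NV-L5 grammar: `NV-L5 BaseThetaDatum.KitCore.NFLink WITNESSED decl BaseThetaDatum.KitCore.NFLink.toy [degenerate]`.
The witness is DEGENERATE and says so (one place, which is bad; `𝒟^⊚`-side = abc-iut-L5-t3's degenerate `NFKit.toy`,
`projAt = 𝟙`; mono-analyticisation tautological); its only purpose is to certify that the inputs of `ofKitCore` are
JOINTLY satisfiable with `𝕍^bad ≠ ∅`, so that no theorem stated over `(KitCore.ofKit …)`/`(NFLink.ofKit …)`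
(`KitNFSideDatum`, `KitNFSideEval`, `KitNFSideProp67`) is vacuous for want of an NF kit over a kit with bad places.
typed ≠ inhabited ≠ discharged; every declaration below is a definition by transport or a kernel-checked theorem.
-/

namespace Literature.IUT.HodgeTheaters

open CategoryTheory

namespace PMBaseKit

variable {l : ℕ}

/-! ### An NF kit does not see the bad / archimedean places -/

/-- **Transport of an NF kit along a change of `𝕍^bad`, `𝕍^arc`.**  The hypothesis structure `NFKit K` ([IUTchI] Def 4.1
(v)(vi), Ex 4.3, Ex 4.5 (i)(ii), Def 6.1 (v)) mentions the kit only through `𝕍`, the ambient categories, the models,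
`𝒟^{⊚±}` seen at `v` and `φ^{Θell}_{•,v}` — never through `𝕍^bad`/`𝕍^arc` — so an NF kit over `K` IS an NF kit over
`{K with bad := b, arc := a}` (every field copied verbatim). ([IUTchI] Def 4.1 (v) p.97) [claim: Mochizuki2012, status: disputed] -/
def NFKit.withPlaces {K : PMBaseKit.{0} l} (N : K.NFKit) (b a : Finset K.V) :
    ({ K with bad := b, arc := a } : PMBaseKit.{0} l).NFKit :=
  { N with }

/-! ### Local objects of the thickened kit, read through the first projection -/

variable (K : PMBaseKit.{0} l)

/-- The first projection of an isomorph of the thickened model `(𝒟_v, pt)` is an isomorph of `𝒟_v`.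
(model plumbing for [IUTchI] Def 4.1 (i) p. 95) ([IUTchI] Def 4.1 (i) p.95) [claim: Mochizuki2012, status: disputed] -/
def thickFst {x : K.V} (X : K.thicken.LocalObj x) : K.LocalObj x :=
  ⟨X.obj.1, by
    obtain ⟨e⟩ := X.property
    have e' := (CategoryTheory.Prod.fst (K.Amb x) Thick).mapIso e
    exact ⟨e'⟩⟩

/-- The first projection of an isomorphism of isomorphs of the thickened model.
(model plumbing for [IUTchI] Def 4.1 (i) p. 95) ([IUTchI] Def 4.1 (i) p.95) [claim: Mochizuki2012, status: disputed] -/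
def thickFstIso {x : K.V} {X Y : K.thicken.LocalObj x} (a : X ≅ Y) : K.thickFst X ≅ K.thickFst Y :=
  ObjectProperty.isoMk _ ((CategoryTheory.Prod.fst _ _).mapIso ((ObjectProperty.ι _).mapIso a))

/-- The underlying morphism of the first projection of an isomorphism is the first component (definitional).
(model plumbing) ([IUTchI] Def 4.1 (i) p.95) [claim: Mochizuki2012, status: disputed] -/
theorem thickFstIso_hom_hom {x : K.V} {X Y : K.thicken.LocalObj x} (a : X ≅ Y) :
    (K.thickFstIso a).hom.hom = a.hom.hom.1 := rfl

/-- First projection of the identity isomorphism. (model plumbing) ([IUTchI] Def 4.1 (i) p.95) [claim: Mochizuki2012, status: disputed] -/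
theorem thickFstIso_refl {x : K.V} (X : K.thicken.LocalObj x) : K.thickFstIso (Iso.refl X) = Iso.refl _ := by
  ext; rfl

/-- First projection of a composite isomorphism. (model plumbing) ([IUTchI] Def 4.1 (i) p.95) [claim: Mochizuki2012, status: disputed] -/
theorem thickFstIso_trans {x : K.V} {X Y Z : K.thicken.LocalObj x} (a : X ≅ Y) (b : Y ≅ Z) :
    K.thickFstIso (a ≪≫ b) = K.thickFstIso a ≪≫ K.thickFstIso b := by
  ext; rfl

/-- The first projection of the thickened model object is the model object (definitional).
(model plumbing) ([IUTchI] Def 4.1 (i) p.95) [claim: Mochizuki2012, status: disputed] -/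
theorem thickFst_localModel (x : K.V) : K.thickFst (K.thicken.localModel x) = K.localModel x := rfl

/-! ### Transport of an NF kit along the thickening -/

variable {K} in
/-- **The NF kit of a thickened kit** (transport of `N : K.NFKit` to abc-iut-L5-t3's `K.thicken`): the `𝒟^⊚`-side
(`†𝒟^⊚`, `𝕍(†𝒟^⊚)`, `LabCusp(†𝒟^⊚)`, `[ε]`, `Aut(C_K) ↠ 𝔽_l^⋇`) is that of `N`; `†𝒟^⊚` seen at `v` is `(N.nfAtV v, pt)`,
the double covering seen at `v` and `φ^NF_{•,v}` acquire the identity `Thick`-component (so the factorisation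
`φ^NF_{•,v} = φ^{Θell}_{•,v} ≫ (𝒟^{⊚±} → 𝒟^⊚)` of Def 6.1 (v) / Ex 4.3 (ii) persists); the local label torsors
`LabCusp(†𝒟_v)`, `η_v` and the label pull-backs of Ex 4.5 (i)(ii) are read through the first projection.
([IUTchI] Def 4.1 (v) p.97) [claim: Mochizuki2012, status: disputed] -/
noncomputable def NFKit.thicken (N : K.NFKit) : K.thicken.NFKit where
  GlobNF := N.GlobNF
  gnfModel := N.gnfModel
  gnf_iso := N.gnf_iso
  nfAtV x := (N.nfAtV x).prod' ((Functor.const N.GlobNF).obj Thick.pt)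
  projAt x := (N.projAt x, 𝟙 Thick.pt)
  phiNF x := (N.phiNF x, 𝟙 Thick.pt)
  phiNF_eq x := by
    rw [N.phiNF_eq x]
    rfl
  Val := N.Val
  valIso := N.valIso
  valIso_refl := N.valIso_refl
  valIso_trans := N.valIso_trans
  valOfV := N.valOfV
  GLabNF := N.GLabNF
  isTorsor_gLabNF := N.isTorsor_gLabNF
  gLabNFMap := N.gLabNFMap
  gLabNFMap_smul := N.gLabNFMap_smul
  gLabNFMap_refl := N.gLabNFMap_refl
  gLabNFMap_trans := N.gLabNFMap_trans
  εLab := N.εLab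
  exists_aut_smul := N.exists_aut_smul
  LabStar x X := N.LabStar x (K.thickFst X)
  isTorsor_labStar x X := N.isTorsor_labStar x (K.thickFst X)
  labStarIso a := N.labStarIso (K.thickFstIso a)
  labStarIso_smul a j c := N.labStarIso_smul (K.thickFstIso a) j c
  labStarIso_refl X := by
    rw [thickFstIso_refl]
    exact N.labStarIso_refl _
  labStarIso_trans f g := by
    rw [thickFstIso_trans]
    exact N.labStarIso_trans _ _
  ηStar x X := N.ηStar x (K.thickFst X)
  labStarIso_η a := N.labStarIso_η (K.thickFstIso a)
  labPull := fun {_ X _} f => N.labPull (X := K.thickFst X) f.1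
  labPull_smul := fun {_ X _} f j c => N.labPull_smul (X := K.thickFst X) f.1 j c
  labPull_pre := fun {_ X X' _} a f c => N.labPull_pre (X := K.thickFst X) (X' := K.thickFst X') (K.thickFstIso a) f.1 c
  labPull_post := fun {x X _ _} f b c => by
    change N.labPull (X := K.thickFst X) (f.1 ≫ (N.nfAtV x).map b.hom) c =
      N.labPull (X := K.thickFst X) f.1 ((N.gLabNFMap b).symm c)
    exact N.labPull_post (X := K.thickFst X) f.1 b c
  labPull_phiNF_εLab x := N.labPull_phiNF_εLab x

/-! ### The evaluation-section binder of a thickened kit -/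

/-- **Evaluation sections over a thickened kit** (KIT-RULE inhabitant of abc-iut-L5-t3's `EvalBinder`, the classes
of abc-iut-L5-t3's `thickDatum`): at a bad place, a morphism `X → Y` of isomorphs of `(𝒟_v, pt)` "arises from an
evaluation section labelled `j ∈ |𝔽_l|`" iff its `Thick`-component is `|j| + 1` (Example 4.4 (i): every label occurs;
(ii): closed under composition with isomorphisms, whose `Thick`-component is `0`; labels well defined since
`j ↦ |j|` is injective). ([IUTchI] Ex 4.4 (i) p.105) [claim: Mochizuki2012, status: disputed] -/
noncomputable def EvalBinder.thick : K.thicken.EvalBinder where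
  IsEvalSection _ j _ _ f := Thick.val f.2 = Multiplicative.ofAdd (FlAbs.absVal l j + 1)
  isoComp _ j _ _ _ a f hf := by
    change Thick.val f.2 * Thick.val a.hom.hom.2 = _
    rw [K.thicken_val_iso_hom a, mul_one]
    exact hf
  compIso _ j _ _ _ f b hf := by
    change Thick.val b.hom.hom.2 * Thick.val f.2 = _
    rw [K.thicken_val_iso_hom b, one_mul]
    exact hf
  exists_section _ j X Y :=
    ⟨Prod.mkHom (X.property.some ≪≫ Y.property.some.symm).hom.1
        (Multiplicative.ofAdd (FlAbs.absVal l j + 1) : Multiplicative ℕ), rfl⟩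
  label_unique _ j j' _ _ f h h' := by
    have h1 := h.symm.trans h'
    have h2 := Multiplicative.ofAdd.injective h1
    exact FlAbs.absVal_injective l (by omega)

/-! ### The toy kit with one bad place -/

variable (l) in
/-- **abc-iut-L5-t4's toy kit with its unique place declared bad** (`𝕍 = {•} = 𝕍^bad`, `𝕍^arc = ∅`; the kit
inlined in abc-iut-L5-t3's `exists_kitCore_thetaAgrees`), for every prime `l ≥ 5` (Def 3.1 (c)).
([IUTchI] Def 6.1 p.156) [claim: Mochizuki2012, status: disputed] -/
noncomputable def toyKitBad [Fact l.Prime] (hl5 : 5 ≤ l) : PMBaseKit.{0} l :=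
  { toyKit l (MultKit.two_ne_of_five_le hl5) with bad := ({PUnit.unit} : Finset Unit), arc := ∅ }

/-- `𝕍^bad ∩ 𝕍^arc = ∅` for the (thickened) one-bad-place toy kit (Def 3.1 (b)(e)). ([IUTchI] Def 3.1 (e) p.62) [claim: Mochizuki2012, status: disputed] -/
theorem toyKitBad_bad_not_arc [Fact l.Prime] (hl5 : 5 ≤ l) :
    ∀ x ∈ (toyKitBad l hl5).thicken.bad, x ∉ (toyKitBad l hl5).thicken.arc :=
  fun _ _ h => (Finset.notMem_empty _ h).elim

/-- `𝕍^bad ≠ ∅` for the (thickened) one-bad-place toy kit (Def 3.1 (e)). ([IUTchI] Def 3.1 (e) p.62) [claim: Mochizuki2012, status: disputed] -/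
theorem toyKitBad_bad_nonempty [Fact l.Prime] (hl5 : 5 ≤ l) : (toyKitBad l hl5).thicken.bad.Nonempty :=
  ⟨PUnit.unit, Finset.mem_singleton_self _⟩

variable (l) in
/-- **The NF kit of the thickened one-bad-place toy kit**: abc-iut-L5-t3's `NFKit.toy`, transported along the change
of places and the thickening. ([IUTchI] Def 4.1 (v) p.97) [claim: Mochizuki2012, status: disputed] -/
noncomputable def NFKit.toyBad [Fact l.Prime] (hl5 : 5 ≤ l) : (toyKitBad l hl5).thicken.NFKit :=
  ((NFKit.toy l (MultKit.two_ne_of_five_le hl5)).withPlaces ({PUnit.unit} : Finset Unit) ∅).thicken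

end PMBaseKit

namespace BaseThetaDatum

open PMBaseKit

variable (l : ℕ) [Fact l.Prime]

/-- **NV-L5 `BaseThetaDatum.KitCore.NFLink` — the CLOSED inhabitant** [degenerate]: over the datum
`ofKitCore` built from the thickened one-bad-place toy kit, its NF kit `NFKit.toyBad`, the tautological mono-analytic
binder and the thick evaluation sections, the `φ^NF`-dictionary `NFLink.ofKit` of the core agreement `KitCore.ofKit`
(`e = id`, `homNF = Subtype.val`). ([IUTchI] Ex 4.3 (ii) p.99) [claim: Mochizuki2012, status: disputed] -/
noncomputable def KitCore.NFLink.toy (hl5 : 5 ≤ l) :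
    (KitCore.ofKit (toyKitBad l hl5).thicken hl5 (toyKitBad_bad_not_arc hl5) (toyKitBad_bad_nonempty hl5)
      (NFKit.toyBad l hl5) (MonoBinder.tautological _) (EvalBinder.thick _)).NFLink :=
  NFLink.ofKit _ hl5 _ _ _ _ _

/-- **NV-L5 `BaseThetaDatum.KitCore.NFLink` WITNESSED [degenerate]**: the `φ^NF`-dictionary structure over the core
agreement of the datum built from the kits is inhabited at CLOSED data with `𝕍^bad ≠ ∅`, for every prime `l ≥ 5`.
([IUTchI] Ex 4.3 (ii) p.99) [claim: Mochizuki2012, status: disputed] -/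
theorem KitCore.NFLink.nonempty_toy (hl5 : 5 ≤ l) :
    Nonempty (KitCore.ofKit (toyKitBad l hl5).thicken hl5 (toyKitBad_bad_not_arc hl5) (toyKitBad_bad_nonempty hl5)
      (NFKit.toyBad l hl5) (MonoBinder.tautological _) (EvalBinder.thick _)).NFLink :=
  ⟨KitCore.NFLink.toy l hl5⟩

/-- **The inputs of `ofKitCore` are jointly satisfiable with `𝕍^bad ≠ ∅`** (packaged): for every prime `l ≥ 5` there
are a base kit `K` with a bad place and no bad archimedean place, an NF kit, a mono-analytic binder and an
evaluation-section binder over it, and the `φ^NF`-dictionary over `KitCore.ofKit` is inhabited there.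
([IUTchI] Def 4.1 p.95) [claim: Mochizuki2012, status: disputed] -/
theorem exists_ofKitCore_inputs_nfLink (hl5 : 5 ≤ l) :
    ∃ (K : PMBaseKit.{0} l) (hba : ∀ x ∈ K.bad, x ∉ K.arc) (hb : K.bad.Nonempty) (N : K.NFKit)
      (B : K.MonoBinder) (E : K.EvalBinder), Nonempty (KitCore.ofKit K hl5 hba hb N B E).NFLink :=
  ⟨_, _, _, _, _, _, KitCore.NFLink.nonempty_toy l hl5⟩

/-- **KIT-RULE for `KitCore.NFLink`** (shape of abc-iut-L5-t3's `exists_kitCore_thetaAgrees`): for every prime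
`l ≥ 5` there exist a §4 datum `𝔡` with `𝔡.l = l`, a §6 base kit `K` for `𝔡.l` with `𝕍^bad ≠ ∅`, a core agreement
`c : KitCore 𝔡 K` with `c.e` bijective, and an inhabitant of `c.NFLink`. ([IUTchI] Ex 4.3 (ii) p.99) [claim: Mochizuki2012, status: disputed] -/
theorem exists_kitCore_nfLink (hl5 : 5 ≤ l) :
    ∃ (𝔡 : BaseThetaDatum.{0}) (K : PMBaseKit.{0} 𝔡.l) (c : 𝔡.KitCore K),
      𝔡.l = l ∧ K.bad.Nonempty ∧ Function.Bijective c.e ∧ Nonempty c.NFLink :=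
  ⟨_, _, _, rfl, toyKitBad_bad_nonempty hl5, Function.bijective_id, KitCore.NFLink.nonempty_toy l hl5⟩

/-- The KIT-RULE witness for `KitCore.NFLink` at `l = 5`. ([IUTchI] Ex 4.3 (ii) p.99) [claim: Mochizuki2012, status: disputed] -/
theorem exists_kitCore_nfLink_five :
    ∃ (𝔡 : BaseThetaDatum.{0}) (K : PMBaseKit.{0} 𝔡.l) (c : 𝔡.KitCore K),
      𝔡.l = 5 ∧ K.bad.Nonempty ∧ Function.Bijective c.e ∧ Nonempty c.NFLink :=
  haveI : Fact (Nat.Prime 5) := ⟨Nat.prime_five⟩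
  exists_kitCore_nfLink 5 le_rfl

end BaseThetaDatum

end Literature.IUT.HodgeTheaters
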